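import Summits.CriticalPhenomena.SAWScalingLimit.Theorems.SAWRenewalTightnessTubeLowerBoundDefs
import Literature.Probability.RandomPlanarGeometry.SAWReflect

/-!
# Crux `SAWRenewalTightness.TubeLowerBound` (stmt-CriticalPhenomena-4730), line `lieb-simon-star`: the domino floor

Registered stub `stub_dominoFloor : QuarterFlux → DominoFloor` of the checked skeleton of the line
`lieb-simon-star` (objects `QuarterFlux`, `DominoFloor`, `supNorm` of
`…Theorems.SAWRenewalTightnessTubeLowerBoundDefs`).

**Statement.** If for every `R ≥ 1` the first-exit walks of the open box `‖·‖∞ < R` leaving through the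
east side `x = R` carry `x_c`-mass `≥ 1/4` (`QuarterFlux`), then for every `R ≥ 1` the `x_c`-mass of
self-avoiding walks `0 → (2R+1, 0)` of length `< 2(2R−1)² + 2` confined to the domino
`[−R, 3R+1] × [−R, R]` is `≥ x_c / (16 (2R+1))` (`DominoFloor`).

**Proof** (Madras–Slade, *The Self-Avoiding Walk* (1993), Lemma 4.1.12, "reflect and Schwarz").
* `glue_mem_sawFun`, `glue_domino`: an east-exit walk `ω` (`m` steps, exit vertex `(R, y)`), one bridging
  edge `(R, y) → (R+1, y)`, and the time reversal of the mirror image `x ↦ 2R+1−x` (`Zd.reflAt 0 (2R+1)`)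
  of a second east-exit walk `ω'` (`m'` steps) with the same exit height `y` form an `(m+m'+1)`-step
  self-avoiding walk `0 → (2R+1, 0)`: the head has abscissae `≤ R`, the reflected tail `≥ R+1`; every
  vertex lies in the domino (the last step of a first-exit walk moves each coordinate by at most one,
  `abs_le_of_box`).
* `glue_inj`: the gluing is injective — `m` is recovered as the first time the abscissa reaches `R`.
* `stub_dominoFloor`: with `A(y)` the `x_c`-mass of east-exit walks with exit height `y ∈ [−R, R]`,
  the injection gives domino mass `≥ x_c Σ_y A(y)²`, Cauchy–Schwarz over the `2R+1` heights
  (`sq_sum_le_card_mul_sum_sq`) gives `Σ_y A(y)² ≥ (Σ_y A(y))² / (2R+1) ≥ (1/16)/(2R+1)`.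
-/

noncomputable section

namespace Summit.CriticalPhenomena.SAWScalingLimit.Theorems.TubeLowerBound.LiebSimonStar

open scoped BigOperators Classical
open Literature.Probability.LatticeModels
open Literature.Probability.RandomPlanarGeometry Literature.Probability.RandomPlanarGeometry.SAW

/-! ### Walks of the open box -/

/-- A self-avoiding walk whose vertices before time `m` lie in the open box `‖·‖∞ < R` has all its
vertices up to time `m` in the closed box `‖·‖∞ ≤ R`: the last step moves each coordinate by at most
one (and `ω 0 = 0` if `m = 0`). -/
theorem abs_le_of_box {R m : ℕ} {ω : ℕ → Site 2} (hω : ω ∈ Zd.saws 2 m)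
    (hb : ∀ i < m, supNorm (ω i) < (R : ℤ)) : ∀ i ≤ m, ∀ j, |ω i j| ≤ (R : ℤ) := by
  obtain ⟨h0, -, hadj, -⟩ := Zd.mem_saws.1 hω
  have hlt : ∀ i < m, ∀ j, |ω i j| < (R : ℤ) := fun i hi =>
    Fin.forall_fin_two.2 (by have h := hb i hi; simp only [supNorm, max_lt_iff] at h; exact h)
  intro i hi j
  rcases hi.lt_or_eq with h | rfl
  · exact (hlt i h j).le
  · rcases Nat.eq_zero_or_pos i with rfl | hpos
    · simp [h0]
    · have h1 := Zd.abs_sub_le_one_of_adj (hadj (i - 1) (by omega)) j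
      rw [Nat.sub_add_cancel hpos] at h1
      have h2 := hlt (i - 1) (by omega) j
      have h3 := abs_sub_abs_le_abs_sub (ω i j) (ω (i - 1) j)
      linarith

/-- The mirror `x ↦ 2R+1−x` of `ℤ²` sends the origin to `(2R+1, 0)`. -/
theorem reflAt_zero (R : ℕ) :
    Zd.reflAt 0 (2 * (R : ℤ) + 1) (0 : Site 2) = ![2 * (R : ℤ) + 1, 0] :=
  funext (Fin.forall_fin_two.2 ⟨by simp, by
    rw [Zd.reflAt_apply_of_ne (show (1 : Fin 2) ≠ 0 by decide)]; simp⟩)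

/-! ### The gluing -/

/-- **Reflect and glue.** For east-exit walks `ω` (`m` steps) and `ω'` (`m'` steps) of the open `R`-box
with the same exit height, the walk that follows `ω`, crosses the edge `(R, y) → (R+1, y)` and then runs
backwards through the mirror image `x ↦ 2R+1−x` of `ω'` is an `(m+m'+1)`-step self-avoiding walk from
`0` to `(2R+1, 0)` (Madras–Slade 1993, proof of Lemma 4.1.12). -/
theorem glue_mem_sawFun {R m m' : ℕ} {ω ω' : ℕ → Site 2}
    (hω : ω ∈ Zd.saws 2 m) (hω' : ω' ∈ Zd.saws 2 m')
    (hb : ∀ i < m, supNorm (ω i) < (R : ℤ)) (hb' : ∀ i < m', supNorm (ω' i) < (R : ℤ))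
    (he : ω m 0 = R) (he' : ω' m' 0 = R) (hy : ω m 1 = ω' m' 1) :
    (fun i => if i ≤ m then ω i else Zd.reflAt 0 (2 * (R : ℤ) + 1) (ω' (m + 1 + m' - i))) ∈
      Zd.sawFun 2 (m + m' + 1) ![2 * (R : ℤ) + 1, 0] := by
  set γ : ℕ → Site 2 := fun i => if i ≤ m then ω i else
    Zd.reflAt 0 (2 * (R : ℤ) + 1) (ω' (m + 1 + m' - i)) with hγ
  have hd : ∀ i, i ≤ m → γ i = ω i := fun i hi => by simp only [hγ, if_pos hi]
  have ht : ∀ i, m < i → γ i = Zd.reflAt 0 (2 * (R : ℤ) + 1) (ω' (m + 1 + m' - i)) :=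
    fun i hi => by simp only [hγ, if_neg (not_le.2 hi)]
  obtain ⟨h0, -, hadj, hinj⟩ := Zd.mem_saws.1 hω
  obtain ⟨h0', -, hadj', hinj'⟩ := Zd.mem_saws.1 hω'
  have hR := abs_le_of_box hω hb
  have hR' := abs_le_of_box hω' hb'
  have hx : ∀ i ≤ m, ω i 0 ≤ R := fun i hi => (abs_le.1 (hR i hi 0)).2
  have hx' : ∀ k ≤ m', (R : ℤ) + 1 ≤ Zd.reflAt 0 (2 * (R : ℤ) + 1) (ω' k) 0 := fun k hk => by
    rw [Zd.reflAt_apply_same]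
    have := (abs_le.1 (hR' k hk 0)).2
    linarith
  have hmm : ω' m' = ω m := funext (Fin.forall_fin_two.2 ⟨he'.trans he.symm, hy.symm⟩)
  refine Zd.mem_sawFun.2 ⟨by rw [hd 0 (Nat.zero_le m), h0], fun i hi => ?_, fun i hi => ?_,
    fun i hi j hj hij => ?_⟩
  · rw [ht i (by omega), show m + 1 + m' - i = 0 by omega, h0', reflAt_zero]
  · rcases lt_trichotomy (i + 1) (m + 1) with h | h | h
    · rw [hd i (by omega), hd (i + 1) (by omega)]
      exact hadj i (by omega)
    · obtain rfl : i = m := by omega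
      rw [hd i le_rfl, ht (i + 1) (by omega), show i + 1 + m' - (i + 1) = m' by omega, hmm,
        show (2 * (R : ℤ) + 1) = 2 * ω i 0 + 1 by rw [he], Zd.reflAt_two_mul_add_one]
      exact (zdGraph_adj_iff _ _).2 ⟨0, Or.inl rfl⟩
    · rw [ht i (by omega), ht (i + 1) (by omega), Zd.zdGraph_adj_reflAt,
        show m + 1 + m' - i = (m + m' - i) + 1 by omega,
        show m + 1 + m' - (i + 1) = m + m' - i by omega]
      exact (hadj' (m + m' - i) (by omega)).symm
  · simp only [Set.mem_setOf_eq] at hi hj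
    by_cases him : i ≤ m <;> by_cases hjm : j ≤ m
    · rw [hd i him, hd j hjm] at hij
      exact hinj (show i ≤ m from him) (show j ≤ m from hjm) hij
    · exfalso
      have h1 := hx i him
      have h2 := hx' (m + 1 + m' - j) (by omega)
      rw [hd i him, ht j (not_le.1 hjm)] at hij
      rw [hij] at h1
      linarith
    · exfalso
      have h1 := hx j hjm
      have h2 := hx' (m + 1 + m' - i) (by omega)
      rw [ht i (not_le.1 him), hd j hjm] at hij
      rw [← hij] at h1
      linarith
    · rw [ht i (not_le.1 him), ht j (not_le.1 hjm)] at hij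
      have := hinj' (show m + 1 + m' - i ≤ m' by omega) (show m + 1 + m' - j ≤ m' by omega)
        (Zd.reflAt_injective 0 _ hij)
      omega

/-- The glued walk lies in the domino `[−R, 3R+1] × [−R, R]`: the head lies in the closed `R`-box
(`abs_le_of_box`), the reflected tail in its mirror image `[R+1, 3R+1] × [−R, R]`. -/
theorem glue_domino {R m m' : ℕ} {ω ω' : ℕ → Site 2}
    (hω : ω ∈ Zd.saws 2 m) (hω' : ω' ∈ Zd.saws 2 m')
    (hb : ∀ i < m, supNorm (ω i) < (R : ℤ)) (hb' : ∀ i < m', supNorm (ω' i) < (R : ℤ)) :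
    ∀ i ≤ m + m' + 1,
      -(R : ℤ) ≤ (if i ≤ m then ω i else Zd.reflAt 0 (2 * (R : ℤ) + 1) (ω' (m + 1 + m' - i))) 0 ∧
      (if i ≤ m then ω i else Zd.reflAt 0 (2 * (R : ℤ) + 1) (ω' (m + 1 + m' - i))) 0 ≤
          3 * (R : ℤ) + 1 ∧
      |(if i ≤ m then ω i else Zd.reflAt 0 (2 * (R : ℤ) + 1) (ω' (m + 1 + m' - i))) 1| ≤
          (R : ℤ) := by
  intro i hi
  have hR := abs_le_of_box hω hb
  have hR' := abs_le_of_box hω' hb'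
  by_cases him : i ≤ m
  · simp only [if_pos him]
    have h0 := abs_le.1 (hR i him 0)
    exact ⟨by linarith, by linarith, hR i him 1⟩
  · simp only [if_neg him, Zd.reflAt_apply_same]
    have h0 := abs_le.1 (hR' (m + 1 + m' - i) (by omega) 0)
    rw [Zd.reflAt_apply_of_ne (show (1 : Fin 2) ≠ 0 by decide)]
    exact ⟨by linarith, by linarith, hR' _ (by omega) 1⟩

/-- In a glued walk the head is recognisable: before time `m` the abscissa is `< R`, at time `m` it is
`R`; so two gluings that agree as walks have head lengths that are not `<`-comparable. -/
theorem le_of_glue_eq {R m₁ m₂ : ℕ} {ω₁ ω₂ t₁ t₂ : ℕ → Site 2}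
    (hb₂ : ∀ i < m₂, supNorm (ω₂ i) < (R : ℤ)) (he₁ : ω₁ m₁ 0 = R)
    (h : (fun i => if i ≤ m₁ then ω₁ i else t₁ i) = fun i => if i ≤ m₂ then ω₂ i else t₂ i) :
    m₂ ≤ m₁ := by
  by_contra hlt
  push Not at hlt
  have h1 := congrFun h m₁
  simp only [le_refl, if_true, if_pos hlt.le] at h1
  have h2 := hb₂ m₁ hlt
  simp only [supNorm, max_lt_iff, ← h1, he₁, abs_lt] at h2
  exact lt_irrefl _ h2.1.2

/-- **The gluing is injective** on pairs of east-exit walks: the head length `m` is the first time the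
abscissa reaches `R` (`le_of_glue_eq`), the head is the walk up to time `m` (then frozen), the tail
length is `n − m − 1`, and the tail is read backwards through the mirror (`Zd.reflAt_injective`). -/
theorem glue_inj {R m₁ m₁' m₂ m₂' : ℕ} {ω₁ ω₁' ω₂ ω₂' : ℕ → Site 2}
    (h₁ : ω₁ ∈ Zd.saws 2 m₁) (h₁' : ω₁' ∈ Zd.saws 2 m₁') (h₂ : ω₂ ∈ Zd.saws 2 m₂)
    (h₂' : ω₂' ∈ Zd.saws 2 m₂')
    (hb₁ : ∀ i < m₁, supNorm (ω₁ i) < (R : ℤ)) (hb₂ : ∀ i < m₂, supNorm (ω₂ i) < (R : ℤ))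
    (he₁ : ω₁ m₁ 0 = R) (he₂ : ω₂ m₂ 0 = R) (hn : m₁ + m₁' + 1 = m₂ + m₂' + 1)
    (h : (fun i => if i ≤ m₁ then ω₁ i else
        Zd.reflAt 0 (2 * (R : ℤ) + 1) (ω₁' (m₁ + 1 + m₁' - i))) =
      fun i => if i ≤ m₂ then ω₂ i else
        Zd.reflAt 0 (2 * (R : ℤ) + 1) (ω₂' (m₂ + 1 + m₂' - i))) :
    m₁ = m₂ ∧ ω₁ = ω₂ ∧ m₁' = m₂' ∧ ω₁' = ω₂' := by
  obtain rfl : m₁ = m₂ := le_antisymm (le_of_glue_eq hb₁ he₂ h.symm) (le_of_glue_eq hb₂ he₁ h)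
  obtain rfl : m₁' = m₂' := by omega
  refine ⟨rfl, ?_, rfl, ?_⟩
  · funext i
    rcases le_or_gt i m₁ with hi | hi
    · simpa [if_pos hi] using congrFun h i
    · rw [(Zd.mem_saws.1 h₁).2.1 i hi.le, (Zd.mem_saws.1 h₂).2.1 i hi.le]
      simpa using congrFun h m₁
  · funext j
    rcases le_or_gt j m₁' with hj | hj
    · have := congrFun h (m₁ + 1 + m₁' - j)
      have hnot : ¬ (m₁ + 1 + m₁' - j ≤ m₁) := by omega
      have hidx : m₁ + 1 + m₁' - (m₁ + 1 + m₁' - j) = j := by omega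
      simp only [if_neg hnot, hidx] at this
      exact Zd.reflAt_injective 0 _ this
    · rw [(Zd.mem_saws.1 h₁').2.1 j hj.le, (Zd.mem_saws.1 h₂').2.1 j hj.le]
      have := congrFun h (m₁ + 1)
      have hnot : ¬ (m₁ + 1 ≤ m₁) := by omega
      have hidx : m₁ + 1 + m₁' - (m₁ + 1) = m₁' := by omega
      simp only [if_neg hnot, hidx] at this
      exact Zd.reflAt_injective 0 _ this

/-! ### Reflect and Schwarz -/

/-- **`QuarterFlux → DominoFloor`** (Madras–Slade 1993, Lemma 4.1.12, applied to the east fan of the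
`R`-box): with `A(y)` the `x_c`-mass of east-exit walks of exit height `y ∈ [−R, R]`, the injective
weight-preserving gluing (`glue_mem_sawFun`, `glue_domino`, `glue_inj`) bounds the domino mass below by
`x_c Σ_y A(y)²`, and Cauchy–Schwarz over the `2R+1` heights together with `Σ_y A(y) ≥ 1/4`
(`QuarterFlux`) gives `x_c / (16 (2R+1))`. -/
theorem stub_dominoFloor : QuarterFlux → DominoFloor := by
  intro hQ R hR
  have hflux := hQ R hR
  set x : ℝ := criticalFugacity with hxdef
  have hx0 : 0 < x := criticalFugacity_pos
  set N : ℕ := (2 * R - 1) ^ 2 with hN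
  set v : Site 2 := ![2 * (R : ℤ) + 1, 0] with hv
  set Efam : Finset (Σ _ : ℕ, ℕ → Site 2) := (Finset.range (N + 1)).sigma fun n =>
    (Zd.saws 2 n).filter (fun ω => (∀ i < n, supNorm (ω i) < (R : ℤ)) ∧ ω n 0 = (R : ℤ)) with hEfam
  set Y : Finset ℤ := Finset.Icc (-(R : ℤ)) R with hY
  set A : ℤ → ℝ := fun y => ∑ p ∈ Efam.filter (fun p => p.2 p.1 1 = y), x ^ p.1 with hA
  set S := (Efam ×ˢ Efam).filter (fun pq => pq.1.2 pq.1.1 1 = pq.2.2 pq.2.1 1) with hS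
  set T : Finset (Σ _ : ℕ, ℕ → Site 2) := (Finset.range (2 * N + 2)).sigma fun n =>
    (Zd.sawFun 2 n v).filter
      (fun ω => ∀ i ≤ n, -(R : ℤ) ≤ ω i 0 ∧ ω i 0 ≤ 3 * (R : ℤ) + 1 ∧ |ω i 1| ≤ (R : ℤ)) with hT
  set G : (Σ _ : ℕ, ℕ → Site 2) × (Σ _ : ℕ, ℕ → Site 2) → (Σ _ : ℕ, ℕ → Site 2) := fun pq =>
    ⟨pq.1.1 + pq.2.1 + 1, fun i => if i ≤ pq.1.1 then pq.1.2 i else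
      Zd.reflAt 0 (2 * (R : ℤ) + 1) (pq.2.2 (pq.1.1 + 1 + pq.2.1 - i))⟩ with hG
  -- exit heights lie in `Y`
  have hexit : ∀ p ∈ Efam, p.2 p.1 1 ∈ Y := by
    rintro ⟨m, ω⟩ hp
    simp only [hEfam, Finset.mem_sigma, Finset.mem_range, Finset.mem_filter] at hp
    obtain ⟨-, hω, hb, -⟩ := hp
    exact Finset.mem_Icc.2 (abs_le.1 (abs_le_of_box hω hb m le_rfl 1))
  -- Step 1: the east flux splits over the exit heights
  have h1 : (1 : ℝ) / 4 ≤ ∑ y ∈ Y, A y := by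
    have : ∑ y ∈ Y, A y = ∑ p ∈ Efam, x ^ p.1 := by
      simp only [hA]
      exact Finset.sum_fiberwise_of_maps_to hexit _
    rw [this, hEfam, Finset.sum_sigma]
    exact hflux
  -- Step 2: the weight of the pairs with equal exit heights is `x Σ_y A(y)²`
  have h2 : ∑ pq ∈ S, x ^ (pq.1.1 + pq.2.1 + 1) = x * ∑ y ∈ Y, A y ^ 2 := by
    rw [← Finset.sum_fiberwise_of_maps_to (s := S) (t := Y) (g := fun pq => pq.1.2 pq.1.1 1)
      (fun pq hpq => hexit _ (Finset.mem_product.1 (Finset.mem_filter.1 hpq).1).1), Finset.mul_sum]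
    refine Finset.sum_congr rfl fun y _ => ?_
    have hfib : S.filter (fun pq => pq.1.2 pq.1.1 1 = y) =
        Efam.filter (fun p => p.2 p.1 1 = y) ×ˢ Efam.filter (fun p => p.2 p.1 1 = y) := by
      ext pq
      simp only [hS, Finset.mem_filter, Finset.mem_product]
      constructor
      · rintro ⟨⟨⟨hp, hq⟩, hpq⟩, hpy⟩
        exact ⟨⟨hp, hpy⟩, hq, hpq ▸ hpy⟩
      · rintro ⟨⟨hp, hpy⟩, hq, hqy⟩
        exact ⟨⟨⟨hp, hq⟩, hpy.trans hqy.symm⟩, hpy⟩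
    rw [hfib, Finset.sum_product]
    simp only [hA]
    rw [sq, Finset.sum_mul_sum, Finset.mul_sum]
    refine Finset.sum_congr rfl fun p _ => ?_
    rw [Finset.mul_sum]
    refine Finset.sum_congr rfl fun q _ => ?_
    ring
  -- Step 3: the gluing injects the pairs into the domino walks, preserving the weight
  have hinj : Set.InjOn G ↑S := by
    rintro ⟨⟨m₁, ω₁⟩, ⟨m₁', ω₁'⟩⟩ hp₁ ⟨⟨m₂, ω₂⟩, ⟨m₂', ω₂'⟩⟩ hp₂ heq
    simp only [Finset.mem_coe, hS, hEfam, Finset.mem_filter, Finset.mem_product, Finset.mem_sigma,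
      Finset.mem_range] at hp₁ hp₂
    obtain ⟨⟨⟨-, hω₁, hb₁, he₁⟩, ⟨-, hω₁', -, -⟩⟩, -⟩ := hp₁
    obtain ⟨⟨⟨-, hω₂, hb₂, he₂⟩, ⟨-, hω₂', -, -⟩⟩, -⟩ := hp₂
    simp only [hG, Sigma.mk.inj_iff, heq_eq_eq] at heq
    obtain ⟨rfl, rfl, rfl, rfl⟩ :=
      glue_inj hω₁ hω₁' hω₂ hω₂' hb₁ hb₂ he₁ he₂ (by have := heq.1; omega) heq.2
    rfl
  have hmaps : S.image G ⊆ T := by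
    intro p hp
    rw [Finset.mem_image] at hp
    obtain ⟨⟨⟨m, ω⟩, ⟨m', ω'⟩⟩, hpq, rfl⟩ := hp
    simp only [hS, hEfam, Finset.mem_filter, Finset.mem_product, Finset.mem_sigma,
      Finset.mem_range] at hpq
    obtain ⟨⟨⟨hm, hω, hb, he⟩, ⟨hm', hω', hb', he'⟩⟩, hy⟩ := hpq
    simp only [hG, hT, Finset.mem_sigma, Finset.mem_range, Finset.mem_filter]
    exact ⟨by omega, glue_mem_sawFun hω hω' hb hb' he he' hy, glue_domino hω hω' hb hb'⟩
  have h3 : ∑ pq ∈ S, x ^ (pq.1.1 + pq.2.1 + 1) ≤ ∑ p ∈ T, x ^ p.1 :=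
    calc ∑ pq ∈ S, x ^ (pq.1.1 + pq.2.1 + 1) = ∑ p ∈ S.image G, x ^ p.1 :=
          (Finset.sum_image (f := fun p => x ^ p.1) hinj).symm
      _ ≤ ∑ p ∈ T, x ^ p.1 :=
          Finset.sum_le_sum_of_subset_of_nonneg hmaps fun _ _ _ => pow_nonneg hx0.le _
  -- Step 4: Cauchy–Schwarz over the `2R+1` exit heights
  have hcard : (Y.card : ℝ) = 2 * R + 1 := by
    have : Y.card = 2 * R + 1 := by rw [hY, Int.card_Icc]; omega
    rw [this]; push_cast; ring
  have hCS : (∑ y ∈ Y, A y) ^ 2 ≤ (2 * R + 1) * ∑ y ∈ Y, A y ^ 2 := by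
    have := sq_sum_le_card_mul_sum_sq (s := Y) (f := A)
    rwa [hcard] at this
  have hsq : (1 : ℝ) / 16 ≤ (2 * R + 1) * ∑ y ∈ Y, A y ^ 2 :=
    calc (1 : ℝ) / 16 = (1 / 4) ^ 2 := by norm_num
      _ ≤ (∑ y ∈ Y, A y) ^ 2 := pow_le_pow_left₀ (by norm_num) h1 2
      _ ≤ _ := hCS
  calc x / (16 * (2 * (R : ℝ) + 1)) ≤ x * ∑ y ∈ Y, A y ^ 2 := by
        rw [div_le_iff₀ (by positivity)]
        have h16 : (1 : ℝ) ≤ (∑ y ∈ Y, A y ^ 2) * (16 * (2 * R + 1)) := by nlinarith [hsq]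
        calc x = x * 1 := (mul_one x).symm
          _ ≤ x * ((∑ y ∈ Y, A y ^ 2) * (16 * (2 * R + 1))) := mul_le_mul_of_nonneg_left h16 hx0.le
          _ = (x * ∑ y ∈ Y, A y ^ 2) * (16 * (2 * (R : ℝ) + 1)) := by ring
    _ = ∑ pq ∈ S, x ^ (pq.1.1 + pq.2.1 + 1) := h2.symm
    _ ≤ ∑ p ∈ T, x ^ p.1 := h3
    _ = _ := by rw [hT, Finset.sum_sigma]

end Summit.CriticalPhenomena.SAWScalingLimit.Theorems.TubeLowerBound.LiebSimonStar

end
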